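import Summits.QuantumFields.YangMills.Theorems.UnitScaleTiltProp7TopMeanGaugeCovariance
import Summits.QuantumFields.YangMills.Theorems.UnitScaleTiltProp7CoverCombLetters
import Summits.QuantumFields.YangMills.Theorems.UnitScaleTiltProp7CoverTwistedChart
import Summits.QuantumFields.YangMills.Theorems.UnitScaleTiltProp7SymAvgGLBridge
import Summits.QuantumFields.YangMills.Theorems.UnitScaleTiltHalvingSmallMembersCoverLift
import Summits.QuantumFields.YangMills.Theorems.UnitScaleTiltCoverDeckNaturality
import HarnessLib

/-!
# Route `UnitScaleTilt`, crux K1 «MinimiserStabilityRegPr» (stmt-QuantumFields-19200), EX row `hGF`, the (L6) LOD line — SMALL MEMBERS VIA THE COVER, ROW (c2), FILE 1∕2: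
# **THE TOP NESTED COVARIANT MEAN OF RECORD `Q″` IS NATURAL UNDER THE `L^{jc}`-FOLD COVER — FOR THE PULLBACK AND FOR THE FIBRE SUM**:
# `Q″_{U₀∘π}(toL2S (λ∘π))(y′) = Q″_{U₀}(toL2S λ)(π y′)` and `Q″_{U₀}(toL2S (π_* g))(y) = π_*(Q″_{U₀∘π}(toL2S g))(y)`, hence `ker` lifts and the fibre sum of `ker` descends

Cell `ym3-torus` (HUMAN RULING D-0037: YM₃ on T³ is ladder rung R3 — NOT d = 4, NOT infinite volume, NOT a mass gap, NOT Clay).  Width seat `ym-routeR-w3` (gen 13);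
chair ★`ym-ust-19200-p1` g24 2026-08-30 03:25:11Z «SMALL MEMBERS VIA THE COVER … (c2) `projR (covLapSite (W∘π)) Q″_cover (y∘π) = (projR (covLapSite W) Q″ y)∘π`», BOOKED
03:35:31Z «(c2) ← routeR-w3 g13» (pin: the transfer only needs `‖R_cover(y∘π)‖² ≤ (L^{jc})³‖R y‖²`; FILE 2 proves the identity, which gives it with equality).
THEOREMS ONLY (0 `def`, 0 `sorry`); `--supports stmt-QuantumFields-19200 --as helper`, count-neutral.  HONEST LABEL (★★OWNER RULING №33 (6)): covering-space bookkeeping of the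
averaging recursion (3.19); nothing of `hT`, the small-member transfer, `hGF`, EX or the crux is proved here.

WHY.  The `hT` binder of ✓`Prop7GaugeFixedRowDoorOfLODTarget.gaugeFixedRow_idx_of_curvedTarget_of_le_coupling` quantifies over every averaging-of-record map `Q″` at `U₀`
(clause `htop`: `Q″(toL2S λ)` is the top `ns (K−n)` of THE averaging sequence of `λ`, (3.19): `ns₀ = λ`, `ns_{j+1}(y) = ns_j(ŷ) − mean_i[ns_j(ŷ) − T·ns_j(ŷ + Γ_{y,i})·T⁻¹]`,
`T = Ū₀⁽ʲ⁾(Γ_{y,i})` the tower transport along the staircase).  To read the cover member's `hT` (cube family has room there) on a SMALL member one needs the three target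
terms to be `(L^{jc})³`× the base terms; for the `R_{Q″}`-term this is FILE 2's projector naturality, whose two kernel hypotheses (✓`Prop7ProjRPullbackIntertwine.projR_intertwine_of_push`:
`π(ker Q″) ⊆ ker Q″_cover`, `π_*(ker Q″_cover) ⊆ ker Q″`) are this file.  Both follow from ONE observation: the cover's transports are the base transports at the projected site
(`Ū₀∘π⁽ʲ⁾ = Ū₀⁽ʲ⁾∘π_j`, ✓`Prop7CoverTwistedChart.iterGL_comp_projBond`; `(V∘π)(Γ_{x̃,w}) = V(Γ_{πx̃,w})`, ✓`SmallMembersCoverLift.holT_comp_projBond`), so (a) `ns_j ∘ π_j` satisfies the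
cover recursion started at `λ∘π`, and (b) the FIBRE SUMS `π_*ns̃_j` of a cover sequence satisfy the base recursion started at `π_*g` — the transport being CONSTANT on each fibre,
and the fibres of `ŷ ↦ y`, `x ↦ x + z` being deck orbits (✓`CoverDeckOrbitSum.sum_deck_site_eq_push_proj`, ✓`CoverDeckNaturality.emb_deck`).  Uniqueness of averaging sequences
(✓`Prop7NSIntertwinerOfRecord.avgSeq_unique`, here in the «up to level k» form since the cover letters are stated for levels `≤ m + K`) identifies the tops.

WHAT IS PROVED (ns `…Theorems.Prop7TopMeanCoverNaturality`).
* §1 (any `Params`): `transl_deck` · ★`push_comp_transl` (`π_*(g∘transl(·) z)(x) = (π_*g)(transl x z)`) · ★`push_comp_emb` (`π_*(g∘emb)(y) = (π_*g)(ŷ)`, levels `j+1 ≤ m+K`) ·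
  `push_conj` (`π_*(a·g·b) = a·(π_*g)·b`) · `avgSeq_unique_upto` (two sequences obeying the recursion below level `k` with the same start agree up to `k`).
* §2 (member `F`, cover `F.cover jc`, background `U₀`, `j + 1 ≤ m + K`): ★`stairHol_cover` (the cover's tower transport at `ỹ` is the base transport at `π ỹ`),
  ★★`avgSeq_comp_proj` (pullback of an averaging sequence is one), ★★`avgSeq_push` (fibre sum of an averaging sequence is one).
* §3 ★★★`topMean_cover` — for ANY `Q₀` of record at `U₀` and ANY `Q₁` of record at `U₀ ∘ π` (their `hseq` clauses VERBATIM as in ✓`Prop7TopMeanGaugeCovariance`):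
  `Q₁ (toL2S (λ ∘ π)) y′ = Q₀ (toL2S λ) (π y′)`; ★★★`topMean_push` — `Q₀ (toL2S (π_* g)) y = π_*(Q₁ (toL2S g)) y`; corollaries ★`topMean_cover_eq_zero`, ★`topMean_push_eq_zero`
  (the two kernel rows FILE 2 feeds to ✓`projR_intertwine_of_push`).
HONEST SCOPE.  Identities; no estimate; nothing at the bond∕`Q_k` level (that is px17 g9's (c1) ✓`Prop7CoverTwistedChartSym`).

References: T. Bałaban, CMP **99** (1985) 389–434 [Balaban1985BackgroundPropagators] ((3.19) p.393, (3.21) p.394); CMP **96** (1984) 223–250 [Balaban1984PropagatorsII]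
((2.15)–(2.19) pp.225–226: operators on a covering torus lift and descend); CMP **109** (1987) 249–301 [Balaban1987RG1] ((0.1)–(0.4), (0.11) pp.251–253); CMP **98** (1985) 17–51
[Balaban1985Averaging] ((9)–(11) pp.18–19, (97) p.32).
-/

set_option autoImplicit false

noncomputable section

open scoped BigOperators Matrix.Norms.L2Operator

namespace Summit.QuantumFields.YangMills.Theorems.Prop7TopMeanCoverNaturality

open Literature.MathematicalPhysics.QuantumFieldTheory.Balaban1983to89
open Literature.MathematicalPhysics.QuantumFieldTheory.Balaban1983to89.T3ContinuumYM3Torus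
open T4Continuum BlockAveraging
open BlockAveraging (Idx)
open B7Prop1Explicit (disp)
open B7Prop1Explicit renaming Site → LSite
open B10Eq27TorusAxialLog (holT transl transl_apply)
open B7TransferAnalyticMean (meanCLM meanCLM_apply)
open B15DeterminingSets (embIter)
open B11Eq103H1Complex (SiteL2K)
open T3SectALandauChart (bgUnits)
open Summit.QuantumFields.YangMills.Theorems.Prop8Chart (emlIterU)
open Summit.QuantumFields.YangMills.Theorems.Prop7SectET3Transport (periodsT3)
open Summit.QuantumFields.YangMills.Theorems.Prop7SectET3HilbertLetters (W₂ toL2S)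
open Summit.QuantumFields.YangMills.Theorems.Prop7NSIntertwinerOfRecord (avgSeq_unique)
open Summit.QuantumFields.YangMills.Theorems.CoverSites
open Summit.QuantumFields.YangMills.Theorems.CoverDeckOrbitSum (sum_deck_site_eq_push_proj)
open Summit.QuantumFields.YangMills.Theorems.CoverDeckNaturality (emb_deck)
open Summit.QuantumFields.YangMills.Theorems.Prop7CoverCombLetters (proj_transl)
open Summit.QuantumFields.YangMills.Theorems.Prop7CoverHilbertPullback (bgUnits_cover)
open Summit.QuantumFields.YangMills.Theorems.Prop7CoverTwistedChart (iterGL_comp_projBond)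
open Summit.QuantumFields.YangMills.Theorems.Prop7SymAvgGL (iterGL_eq_emlIterU)
open Summit.QuantumFields.YangMills.Theorems.SmallMembersCoverLift (holT_comp_projBond)

/-! ## §1 Fibre sums versus translations, block centres and conjugations; uniqueness of averaging sequences up to a level -/

section Fibre

variable (P : Params) (jc : ℕ)

/-- The deck translation `x̃ ↦ x̃ + c·N_i` commutes with `transl(·) z`. [cite: Balaban1987RG1, (0.1) p.251] -/
theorem transl_deck (i : ℕ) (c : Fin P.d → Fin (P.L ^ jc)) (x : Site (cover P jc) i) (z : LSite P.d) :
    transl (P := cover P jc) (fun ν => x ν + (((c ν : ℕ) * P.sitesPerDir i : ℕ) : ZMod ((cover P jc).sitesPerDir i))) z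
      = fun ν => transl x z ν + (((c ν : ℕ) * P.sitesPerDir i : ℕ) : ZMod ((cover P jc).sitesPerDir i)) := by
  funext ν
  simp only [transl_apply]
  ring

variable {M : Type*} [AddCommMonoid M]

/-- Fibre sums only see the values on the fibre: pointwise agreement on `π⁻¹(x)` suffices. [folklore] -/
theorem push_congr_fibre (i : ℕ) {g g' : Site (cover P jc) i → M} {x : Site P i} (h : ∀ xt, proj P jc i xt = x → g xt = g' xt) :
    push P jc i g x = push P jc i g' x := by
  rw [push_apply, push_apply]
  exact Finset.sum_congr rfl fun xt hxt => h xt (Finset.mem_filter.mp hxt).2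

/-- Fibre sums commute with additive maps (e.g. the index mean `meanCLM`). [folklore] -/
theorem push_map {N : Type*} [AddCommMonoid N] {Φ : Type*} [FunLike Φ M N] [AddMonoidHomClass Φ M N] (φ : Φ) (i : ℕ) (g : Site (cover P jc) i → M) (x : Site P i) :
    push P jc i (fun xt => φ (g xt)) x = φ (push P jc i g x) := by
  rw [push_apply, push_apply, map_sum]

/-- Fibre sums of function-valued fields are taken componentwise. [folklore] -/
theorem push_pi_apply {ι : Type*} (i : ℕ) (G : Site (cover P jc) i → ι → M) (x : Site P i) (k : ι) :
    push P jc i G x k = push P jc i (fun xt => G xt k) x := by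
  rw [push_apply, push_apply, Finset.sum_apply]

/-- ★ **FIBRE SUMS ARE TRANSLATION-EQUIVARIANT**: `π_*(g ∘ transl(·) z)(x) = (π_* g)(transl x z)` (`i ≤ m + K`; the fibre of `transl x z` is the translate of the fibre of `x`, both
deck orbits). [cite: Balaban1987RG1, (0.1) p.251] -/
theorem push_comp_transl (i : ℕ) (hi : i ≤ P.m + P.K) (g : Site (cover P jc) i → M) (x : Site P i) (z : LSite P.d) :
    push P jc i (fun xt => g (transl xt z)) x = push P jc i g (transl x z) := by
  obtain ⟨xt, rfl⟩ := proj_surjective P jc i x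
  rw [← sum_deck_site_eq_push_proj P jc hi (fun xt => g (transl xt z)) xt, ← proj_transl,
    ← sum_deck_site_eq_push_proj P jc hi g (transl xt z)]
  refine Finset.sum_congr rfl fun c _ => ?_
  simp only [transl_deck]

/-- ★ **FIBRE SUMS COMMUTE WITH BLOCK CENTRES**: `π_*(g ∘ emb)(y) = (π_* g)(ŷ)` — the fibre of `y` at level `i+1` is carried by `emb` onto the fibre of `ŷ` at level `i`
(`i + 1 ≤ m + K`; ✓`emb_deck`). [cite: Balaban1987RG1, (0.1)–(0.3) pp.251–252] -/
theorem push_comp_emb (i : ℕ) (hi : i + 1 ≤ P.m + P.K) (g : Site (cover P jc) i → M) (y : Site P (i + 1)) :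
    push P jc (i + 1) (fun yt => g (emb yt)) y = push P jc i g (emb y) := by
  obtain ⟨yt, rfl⟩ := proj_surjective P jc (i + 1) y
  rw [← sum_deck_site_eq_push_proj P jc hi (fun yt => g (emb yt)) yt, ← proj_emb P jc i hi,
    ← sum_deck_site_eq_push_proj P jc (Nat.le_of_succ_le hi) g (emb yt)]
  refine Finset.sum_congr rfl fun c _ => ?_
  have h := emb_deck P jc (fun ν => (c ν : ℕ)) i hi yt
  exact congrArg g h

/-- Fibre sums commute with a fixed conjugation: `π_*(x̃ ↦ a·g(x̃)·b) = a·(π_* g)·b`. [folklore] -/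
theorem push_conj {𝔸 : Type*} [NonUnitalNonAssocSemiring 𝔸] (i : ℕ) (a b : 𝔸) (g : Site (cover P jc) i → 𝔸) (x : Site P i) :
    push P jc i (fun xt => a * g xt * b) x = a * push P jc i g x * b := by
  rw [push_apply, push_apply, Finset.mul_sum, Finset.sum_mul]

/-- Fibre sums are subtractive. [folklore] -/
theorem push_sub {𝔸 : Type*} [AddCommGroup 𝔸] (i : ℕ) (g h : Site (cover P jc) i → 𝔸) (x : Site P i) :
    push P jc i (fun xt => g xt - h xt) x = push P jc i g x - push P jc i h x := by
  rw [push_apply, push_apply, push_apply, Finset.sum_sub_distrib]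

end Fibre

section Unique

variable {P : Params} {𝔸 : Type*} [NormedRing 𝔸] [NormedAlgebra ℂ 𝔸]

/-- **AVERAGING SEQUENCES WITH THE SAME START AGREE UP TO LEVEL `k`** whenever both obey the (3.19) recursion below `k` (the «up to a level» form of ✓`avgSeq_unique`, needed because
the cover letters are stated for levels `≤ m + K`). [cite: Balaban1985BackgroundPropagators, (3.19) p.393] -/
theorem avgSeq_unique_upto (T : (j : ℕ) → Site P (j + 1) → Idx P → 𝔸ˣ) (k : ℕ) (ns ns' : (j : ℕ) → Site P j → 𝔸) (h0 : ns 0 = ns' 0)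
    (hns : ∀ j, j < k → ∀ y : Site P (j + 1), ns (j + 1) y = ns j (emb y) - meanCLM (Idx P) 𝔸 fun i : Idx P =>
        ns j (emb y) - ((T j y i : 𝔸ˣ) : 𝔸) * ns j (transl (emb y) (disp (stairWord i.2.1 (off i.1)))) * (((T j y i)⁻¹ : 𝔸ˣ) : 𝔸))
    (hns' : ∀ j, j < k → ∀ y : Site P (j + 1), ns' (j + 1) y = ns' j (emb y) - meanCLM (Idx P) 𝔸 fun i : Idx P =>
        ns' j (emb y) - ((T j y i : 𝔸ˣ) : 𝔸) * ns' j (transl (emb y) (disp (stairWord i.2.1 (off i.1)))) * (((T j y i)⁻¹ : 𝔸ˣ) : 𝔸)) :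
    ∀ j, j ≤ k → ns j = ns' j
  | 0, _ => h0
  | j + 1, hj => by
    funext y
    rw [hns j (Nat.lt_of_succ_le hj), hns' j (Nat.lt_of_succ_le hj), avgSeq_unique_upto T k ns ns' h0 hns hns' j (Nat.le_of_succ_le hj)]

end Unique

/-! ## §2 The cover's transports; pullbacks and fibre sums of averaging sequences -/

section Tower

variable (F : T3Family) (jc : ℕ) {K : ℕ} (U₀ : GaugeField (F.P K) 0 (Matrix.specialUnitaryGroup (Fin 2) ℂ))

/-- The `j`-fold (0.4) average of the lifted background is the lift of the `j`-fold average, in `(M₂)ˣ` (✓`iterGL_comp_projBond` ∘ ✓`iterGL_eq_emlIterU`; `j ≤ m + K`).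
[cite: Balaban1987RG1, (0.11) p.253] -/
theorem emlIterU_bgUnits_cover (j : ℕ) (hj : j ≤ (F.P K).m + (F.P K).K) :
    emlIterU j (bgUnits (F.cover jc) K (U₀ ∘ projBond (F.P K) jc 0)) = emlIterU j (bgUnits F K U₀) ∘ projBond (F.P K) jc j := by
  rw [bgUnits_cover, ← iterGL_eq_emlIterU, ← iterGL_eq_emlIterU]
  exact iterGL_comp_projBond (F.P K) jc (bgUnits F K U₀) j hj

/-- ★ **THE COVER'S TOWER TRANSPORT AT `ỹ` IS THE BASE TRANSPORT AT `π ỹ`**: `(Ū₀∘π)⁽ʲ⁾(Γ_{ỹ,w}) = Ū₀⁽ʲ⁾(Γ_{πỹ,w})` along any word `w` from the block centre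
(transports ✓`holT_comp_projBond`, centres ✓`proj_emb`; levels `j + 1 ≤ m + K`). [cite: Balaban1987RG1, (0.4) and (0.11) p.253; Balaban1985Averaging, (9) p.18] -/
theorem stairHol_cover (j : ℕ) (hj : j + 1 ≤ (F.P K).m + (F.P K).K) (yt : Site ((F.cover jc).P K) (j + 1)) (w : List (Letter (F.P K).d)) :
    holT (emlIterU j (bgUnits (F.cover jc) K (U₀ ∘ projBond (F.P K) jc 0))) (emb yt) w
      = holT (emlIterU j (bgUnits F K U₀)) (emb (proj (F.P K) jc (j + 1) yt)) w := by
  rw [emlIterU_bgUnits_cover F jc U₀ j (Nat.le_of_succ_le hj)]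
  exact (holT_comp_projBond (P := F.P K) (jc := jc) (emlIterU j (bgUnits F K U₀)) w (emb yt)).trans
    (congrArg (fun x => holT (emlIterU j (bgUnits F K U₀)) x w) (proj_emb (F.P K) jc j hj yt))

/-- **THE INDEX MEAN OF THE COVER MEMBER IS THE INDEX MEAN OF THE MEMBER**: the block index set `Idx` and the centred offsets `off` depend on `(d, L)` only, which the cover shares
with the base; stated for means of functions of the staircase word (the shape of the (3.19) recursion term), so that the two members' recursions can be compared letter by letter.
[cite: Balaban1987RG1, (0.3) p.252; Balaban1985BackgroundPropagators, (3.19) p.393] -/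
theorem meanCLM_stair_cover {𝔸 : Type*} [NormedRing 𝔸] [NormedAlgebra ℂ 𝔸] (Φ : List (Letter (F.P K).d) → LSite (F.P K).d → 𝔸) :
    meanCLM (Idx ((F.cover jc).P K)) 𝔸 (fun i : Idx ((F.cover jc).P K) =>
        Φ (stairWord (d := ((F.cover jc).P K).d) i.2.1 (off i.1)) (disp (d := ((F.cover jc).P K).d) (stairWord (d := ((F.cover jc).P K).d) i.2.1 (off i.1))))
      = meanCLM (Idx (F.P K)) 𝔸 (fun i : Idx (F.P K) => Φ (stairWord i.2.1 (off i.1)) (disp (stairWord i.2.1 (off i.1)))) := rfl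

/-- ★★ **THE PULLBACK OF AN AVERAGING SEQUENCE IS AN AVERAGING SEQUENCE** (on the cover, for the lifted background, below level `m + K`): if `ns` obeys (3.19) at `U₀`, then
`j ↦ ns_j ∘ π_j` obeys (3.19) at `U₀ ∘ π`. [cite: Balaban1985BackgroundPropagators, (3.19) p.393; Balaban1984PropagatorsII, (2.16) p.225] -/
theorem avgSeq_comp_proj (ns : (j : ℕ) → Site (F.P K) j → Matrix (Fin 2) (Fin 2) ℂ)
    (hns : ∀ (j : ℕ) (y : Site (F.P K) (j + 1)), ns (j + 1) y = ns j (emb y) - meanCLM (Idx (F.P K)) (Matrix (Fin 2) (Fin 2) ℂ) fun i : Idx (F.P K) =>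
      ns j (emb y) - ((holT (emlIterU j (bgUnits F K U₀)) (emb y) (stairWord i.2.1 (off i.1)) : (Matrix (Fin 2) (Fin 2) ℂ)ˣ) : Matrix (Fin 2) (Fin 2) ℂ) *
        ns j (transl (emb y) (disp (stairWord i.2.1 (off i.1)))) * (((holT (emlIterU j (bgUnits F K U₀)) (emb y) (stairWord i.2.1 (off i.1)))⁻¹ : (Matrix (Fin 2) (Fin 2) ℂ)ˣ) : Matrix (Fin 2) (Fin 2) ℂ))
    (j : ℕ) (hj : j + 1 ≤ (F.P K).m + (F.P K).K) (yt : Site ((F.cover jc).P K) (j + 1)) :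
    (fun (j : ℕ) (zt : Site ((F.cover jc).P K) j) => ns j (proj (F.P K) jc j zt)) (j + 1) yt
      = (fun (j : ℕ) (zt : Site ((F.cover jc).P K) j) => ns j (proj (F.P K) jc j zt)) j (emb yt)
        - meanCLM (Idx ((F.cover jc).P K)) (Matrix (Fin 2) (Fin 2) ℂ) fun i : Idx ((F.cover jc).P K) =>
          (fun (j : ℕ) (zt : Site ((F.cover jc).P K) j) => ns j (proj (F.P K) jc j zt)) j (emb yt)
          - ((holT (emlIterU j (bgUnits (F.cover jc) K (U₀ ∘ projBond (F.P K) jc 0))) (emb yt) (stairWord i.2.1 (off i.1)) : (Matrix (Fin 2) (Fin 2) ℂ)ˣ) : Matrix (Fin 2) (Fin 2) ℂ) *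
            (fun (j : ℕ) (zt : Site ((F.cover jc).P K) j) => ns j (proj (F.P K) jc j zt)) j (transl (emb yt) (disp (stairWord i.2.1 (off i.1))))
            * (((holT (emlIterU j (bgUnits (F.cover jc) K (U₀ ∘ projBond (F.P K) jc 0))) (emb yt) (stairWord i.2.1 (off i.1)))⁻¹ : (Matrix (Fin 2) (Fin 2) ℂ)ˣ) : Matrix (Fin 2) (Fin 2) ℂ) := by
  -- the two lattice facts, spelled on the cover member's sites (`emb yt : Site ((F.cover jc).P K) j`)
  have pe : proj (F.P K) jc j (emb yt : Site ((F.cover jc).P K) j) = emb (proj (F.P K) jc (j + 1) yt) := proj_emb (F.P K) jc j hj yt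
  have pt : ∀ z : LSite ((F.cover jc).P K).d,
      proj (F.P K) jc j (transl (emb yt : Site ((F.cover jc).P K) j) z : Site ((F.cover jc).P K) j)
        = transl (proj (F.P K) jc j (emb yt : Site ((F.cover jc).P K) j)) z :=
    fun z => proj_transl (P := F.P K) (jc := jc) (i := j) (emb yt) z
  beta_reduce
  rw [hns j (proj (F.P K) jc (j + 1) yt)]
  -- the base's index mean of the recursion term, re-spelled as the cover's index mean
  have key := meanCLM_stair_cover F jc (𝔸 := Matrix (Fin 2) (Fin 2) ℂ) fun w z =>
    ns j (emb (proj (F.P K) jc (j + 1) yt)) - ((holT (emlIterU j (bgUnits F K U₀)) (emb (proj (F.P K) jc (j + 1) yt)) w : (Matrix (Fin 2) (Fin 2) ℂ)ˣ) : Matrix (Fin 2) (Fin 2) ℂ) *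
      ns j (transl (emb (proj (F.P K) jc (j + 1) yt)) z) * (((holT (emlIterU j (bgUnits F K U₀)) (emb (proj (F.P K) jc (j + 1) yt)) w)⁻¹ : (Matrix (Fin 2) (Fin 2) ℂ)ˣ) : Matrix (Fin 2) (Fin 2) ℂ)
  beta_reduce at key
  rw [← key]
  congr 1
  · rw [pe]
  · congr 1
    funext i
    simp only [stairHol_cover F jc U₀ j hj yt, pt, pe]

/-- ★★ **THE FIBRE SUM OF AN AVERAGING SEQUENCE IS AN AVERAGING SEQUENCE** (on the base, below level `m + K`): if `ñs` obeys (3.19) at `U₀ ∘ π` on the cover, then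
`j ↦ π_*ñs_j` obeys (3.19) at `U₀` — the transport is CONSTANT on each fibre (`stairHol_cover`), the mean is linear, and the fibres of `ŷ`, `ŷ + Γ` are reached by `emb`, `transl`
(`push_comp_emb`, `push_comp_transl`). [cite: Balaban1985BackgroundPropagators, (3.19) p.393; Balaban1984PropagatorsII, (2.17) p.225] -/
theorem avgSeq_push (ms : (j : ℕ) → Site ((F.cover jc).P K) j → Matrix (Fin 2) (Fin 2) ℂ)
    (hms : ∀ (j : ℕ) (yt : Site ((F.cover jc).P K) (j + 1)), ms (j + 1) yt = ms j (emb yt) - meanCLM (Idx ((F.cover jc).P K)) (Matrix (Fin 2) (Fin 2) ℂ) fun i : Idx ((F.cover jc).P K) =>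
      ms j (emb yt) - ((holT (emlIterU j (bgUnits (F.cover jc) K (U₀ ∘ projBond (F.P K) jc 0))) (emb yt) (stairWord i.2.1 (off i.1)) : (Matrix (Fin 2) (Fin 2) ℂ)ˣ) : Matrix (Fin 2) (Fin 2) ℂ) *
        ms j (transl (emb yt) (disp (stairWord i.2.1 (off i.1)))) *
          (((holT (emlIterU j (bgUnits (F.cover jc) K (U₀ ∘ projBond (F.P K) jc 0))) (emb yt) (stairWord i.2.1 (off i.1)))⁻¹ : (Matrix (Fin 2) (Fin 2) ℂ)ˣ) : Matrix (Fin 2) (Fin 2) ℂ))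
    (j : ℕ) (hj : j + 1 ≤ (F.P K).m + (F.P K).K) (y : Site (F.P K) (j + 1)) :
    (fun (j : ℕ) (z : Site (F.P K) j) => push (F.P K) jc j (ms j) z) (j + 1) y
      = (fun (j : ℕ) (z : Site (F.P K) j) => push (F.P K) jc j (ms j) z) j (emb y)
        - meanCLM (Idx (F.P K)) (Matrix (Fin 2) (Fin 2) ℂ) fun i : Idx (F.P K) =>
          (fun (j : ℕ) (z : Site (F.P K) j) => push (F.P K) jc j (ms j) z) j (emb y)
          - ((holT (emlIterU j (bgUnits F K U₀)) (emb y) (stairWord i.2.1 (off i.1)) : (Matrix (Fin 2) (Fin 2) ℂ)ˣ) : Matrix (Fin 2) (Fin 2) ℂ) *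
            (fun (j : ℕ) (z : Site (F.P K) j) => push (F.P K) jc j (ms j) z) j (transl (emb y) (disp (stairWord i.2.1 (off i.1))))
            * (((holT (emlIterU j (bgUnits F K U₀)) (emb y) (stairWord i.2.1 (off i.1)))⁻¹ : (Matrix (Fin 2) (Fin 2) ℂ)ˣ) : Matrix (Fin 2) (Fin 2) ℂ) := by
  simp only
  -- Step 1: on the fibre of `y` the cover recursion has the BASE transport at `y` (staircase words spelled on the base member)
  have step1 : push (F.P K) jc (j + 1) (ms (j + 1)) y
      = push (F.P K) jc (j + 1) (fun yt => ms j (emb yt) - meanCLM (Idx (F.P K)) (Matrix (Fin 2) (Fin 2) ℂ) fun i : Idx (F.P K) =>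
          ms j (emb yt) - ((holT (emlIterU j (bgUnits F K U₀)) (emb y) (stairWord i.2.1 (off i.1)) : (Matrix (Fin 2) (Fin 2) ℂ)ˣ) : Matrix (Fin 2) (Fin 2) ℂ) *
            ms j (transl (emb yt) (disp (stairWord i.2.1 (off i.1)) : LSite (F.P K).d)) *
              (((holT (emlIterU j (bgUnits F K U₀)) (emb y) (stairWord i.2.1 (off i.1)))⁻¹ : (Matrix (Fin 2) (Fin 2) ℂ)ˣ) : Matrix (Fin 2) (Fin 2) ℂ)) y := by
    refine push_congr_fibre (F.P K) jc (j + 1) fun yt hyt => ?_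
    have ht : ∀ w : List (Letter (F.P K).d), holT (emlIterU j (bgUnits (F.cover jc) K (U₀ ∘ projBond (F.P K) jc 0))) (emb yt : Site ((F.cover jc).P K) j) w
        = holT (emlIterU j (bgUnits F K U₀)) (emb y) w := fun w =>
      (stairHol_cover F jc U₀ j hj yt w).trans (by rw [hyt])
    rw [hms j yt]
    simp only [ht]
    -- the cover's index mean of the recursion term is the base's index mean
    have key := meanCLM_stair_cover F jc (𝔸 := Matrix (Fin 2) (Fin 2) ℂ) fun w z =>
      ms j (emb yt : Site ((F.cover jc).P K) j) - ((holT (emlIterU j (bgUnits F K U₀)) (emb y) w : (Matrix (Fin 2) (Fin 2) ℂ)ˣ) : Matrix (Fin 2) (Fin 2) ℂ) *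
        ms j (transl (emb yt : Site ((F.cover jc).P K) j) z) * (((holT (emlIterU j (bgUnits F K U₀)) (emb y) w)⁻¹ : (Matrix (Fin 2) (Fin 2) ℂ)ˣ) : Matrix (Fin 2) (Fin 2) ℂ)
    beta_reduce at key
    rw [key]
  -- Step 2: the generic fibre-sum letters, restated in the cover member's spelling
  have e1 : push (F.P K) jc (j + 1) (fun yt => ms j (emb yt)) y = push (F.P K) jc j (ms j) (emb y) := push_comp_emb (F.P K) jc j hj (ms j) y
  have e2 : ∀ i : Idx (F.P K), push (F.P K) jc (j + 1) (fun yt => ms j (transl (emb yt) (disp (stairWord i.2.1 (off i.1)) : LSite (F.P K).d))) y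
      = push (F.P K) jc j (ms j) (transl (emb y) (disp (stairWord i.2.1 (off i.1)))) := fun i =>
    (push_comp_emb (F.P K) jc j hj (fun xt => ms j (transl xt (disp (stairWord i.2.1 (off i.1)) : LSite (F.P K).d))) y).trans
      (push_comp_transl (F.P K) jc j (Nat.le_of_succ_le hj) (ms j) (emb y) (disp (stairWord i.2.1 (off i.1))))
  rw [step1, push_sub, push_map, e1]
  congr 1
  congr 1
  funext i
  rw [push_pi_apply, push_sub, push_conj, e1, e2 i]

end Tower

/-! ## §3 The top mean of record under the cover: pullback and fibre sum -/

section Top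

variable (F : T3Family) (jc : ℕ) {n K : ℕ} (hnK : n ≤ K) {c₀ : ℝ} (U₀ : GaugeField (F.P K) 0 (Matrix.specialUnitaryGroup (Fin 2) ℂ))
  (Q₀ : SiteL2K ℂ 3 (periodsT3 F K) c₀ W₂ →ₗ[ℂ] (Site (F.P K) (K - n) → Matrix (Fin 2) (Fin 2) ℂ))
  (hseq₀ : ∀ lam : Site (F.P K) 0 → Matrix (Fin 2) (Fin 2) ℂ, ∃ ns : (j : ℕ) → Site (F.P K) j → Matrix (Fin 2) (Fin 2) ℂ, ns 0 = lam ∧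
    (∀ (j : ℕ) (y : Site (F.P K) (j + 1)), ns (j + 1) y = ns j (emb y) - meanCLM (Idx (F.P K)) (Matrix (Fin 2) (Fin 2) ℂ) fun i : Idx (F.P K) =>
      ns j (emb y) - ((holT (emlIterU j (bgUnits F K U₀)) (emb y) (stairWord i.2.1 (off i.1)) : (Matrix (Fin 2) (Fin 2) ℂ)ˣ) : Matrix (Fin 2) (Fin 2) ℂ) *
        ns j (transl (emb y) (disp (stairWord i.2.1 (off i.1)))) * (((holT (emlIterU j (bgUnits F K U₀)) (emb y) (stairWord i.2.1 (off i.1)))⁻¹ : (Matrix (Fin 2) (Fin 2) ℂ)ˣ) : Matrix (Fin 2) (Fin 2) ℂ)) ∧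
    ns (K - n) = Q₀ (toL2S F K c₀ lam))
  (Q₁ : SiteL2K ℂ 3 (periodsT3 (F.cover jc) K) c₀ W₂ →ₗ[ℂ] (Site ((F.cover jc).P K) (K - n) → Matrix (Fin 2) (Fin 2) ℂ))
  (hseq₁ : ∀ lam : Site ((F.cover jc).P K) 0 → Matrix (Fin 2) (Fin 2) ℂ, ∃ ns : (j : ℕ) → Site ((F.cover jc).P K) j → Matrix (Fin 2) (Fin 2) ℂ, ns 0 = lam ∧
    (∀ (j : ℕ) (y : Site ((F.cover jc).P K) (j + 1)), ns (j + 1) y = ns j (emb y) - meanCLM (Idx ((F.cover jc).P K)) (Matrix (Fin 2) (Fin 2) ℂ) fun i : Idx ((F.cover jc).P K) =>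
      ns j (emb y) - ((holT (emlIterU j (bgUnits (F.cover jc) K (U₀ ∘ projBond (F.P K) jc 0))) (emb y) (stairWord i.2.1 (off i.1)) : (Matrix (Fin 2) (Fin 2) ℂ)ˣ) : Matrix (Fin 2) (Fin 2) ℂ) *
        ns j (transl (emb y) (disp (stairWord i.2.1 (off i.1)))) *
          (((holT (emlIterU j (bgUnits (F.cover jc) K (U₀ ∘ projBond (F.P K) jc 0))) (emb y) (stairWord i.2.1 (off i.1)))⁻¹ : (Matrix (Fin 2) (Fin 2) ℂ)ˣ) : Matrix (Fin 2) (Fin 2) ℂ)) ∧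
    ns (K - n) = Q₁ (toL2S (F.cover jc) K c₀ lam))

include hnK hseq₀ hseq₁

/-- ★★★ **THE TOP NESTED COVARIANT MEAN OF RECORD IS NATURAL UNDER THE PULLBACK**: for ANY `Q₀` of record at `U₀` and ANY `Q₁` of record at the lifted background `U₀ ∘ π`,
`Q₁(toL2S (λ∘π))(y′) = Q₀(toL2S λ)(π y′)`. [cite: Balaban1985BackgroundPropagators, (3.19) p.393; Balaban1984PropagatorsII, (2.16) p.225; Balaban1987RG1, (0.11) p.253] -/
theorem topMean_cover (lam : Site (F.P K) 0 → Matrix (Fin 2) (Fin 2) ℂ) (yt : Site ((F.cover jc).P K) (K - n)) :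
    Q₁ (toL2S (F.cover jc) K c₀ (fun xt => lam (proj (F.P K) jc 0 xt))) yt = Q₀ (toL2S F K c₀ lam) (proj (F.P K) jc (K - n) yt) := by
  have hmK : K - n ≤ (F.P K).m + (F.P K).K := by
    show K - n ≤ F.m + K
    omega
  obtain ⟨ns, h0, hrec, htop⟩ := hseq₀ lam
  obtain ⟨ns', h0', hrec', htop'⟩ := hseq₁ (fun xt => lam (proj (F.P K) jc 0 xt))
  -- the pulled-back sequence obeys the cover recursion below `K − n` and starts at `λ ∘ π`
  have huniq := avgSeq_unique_upto
    (fun (j : ℕ) (yt : Site ((F.cover jc).P K) (j + 1)) (i : Idx ((F.cover jc).P K)) =>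
      holT (emlIterU j (bgUnits (F.cover jc) K (U₀ ∘ projBond (F.P K) jc 0))) (emb yt) (stairWord i.2.1 (off i.1)))
    (K - n) (fun (j : ℕ) (zt : Site ((F.cover jc).P K) j) => ns j (proj (F.P K) jc j zt)) ns'
    (by funext zt; rw [h0', h0]) (fun j hj yt => avgSeq_comp_proj F jc U₀ ns hrec j (by omega) yt) (fun j _ yt => hrec' j yt) (K - n) le_rfl
  have hy : ns (K - n) (proj (F.P K) jc (K - n) yt) = ns' (K - n) yt := congrFun huniq yt
  rw [← htop', ← hy, htop]

/-- ★★★ **THE TOP NESTED COVARIANT MEAN OF RECORD IS NATURAL UNDER THE FIBRE SUM**: `Q₀(toL2S (π_* g))(y) = π_*(Q₁(toL2S g))(y)` (`π_*` = ✓`CoverSites.push`, levels `0` and `K − n`).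
[cite: Balaban1985BackgroundPropagators, (3.19) p.393; Balaban1984PropagatorsII, (2.17) p.225; Balaban1987RG1, (0.11) p.253] -/
theorem topMean_push (g : Site ((F.cover jc).P K) 0 → Matrix (Fin 2) (Fin 2) ℂ) (y : Site (F.P K) (K - n)) :
    Q₀ (toL2S F K c₀ (push (F.P K) jc 0 g)) y = push (F.P K) jc (K - n) (Q₁ (toL2S (F.cover jc) K c₀ g)) y := by
  have hmK : K - n ≤ (F.P K).m + (F.P K).K := by
    show K - n ≤ F.m + K
    omega
  obtain ⟨ms, h0', hrec', htop'⟩ := hseq₁ g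
  obtain ⟨ns, h0, hrec, htop⟩ := hseq₀ (push (F.P K) jc 0 g)
  -- the fibre-summed sequence obeys the base recursion below `K − n` and starts at `π_* g`
  have huniq := avgSeq_unique_upto
    (fun (j : ℕ) (y : Site (F.P K) (j + 1)) (i : Idx (F.P K)) => holT (emlIterU j (bgUnits F K U₀)) (emb y) (stairWord i.2.1 (off i.1)))
    (K - n) (fun (j : ℕ) (z : Site (F.P K) j) => push (F.P K) jc j (ms j) z) ns
    (by funext z; rw [h0', h0]) (fun j hj y => avgSeq_push F jc U₀ ms hrec' j (by omega) y) (fun j _ y => hrec j y) (K - n) le_rfl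
  have hy : push (F.P K) jc (K - n) (ms (K - n)) y = ns (K - n) y := congrFun huniq y
  rw [← htop, ← hy, htop']

/-- ★ **THE KERNEL LIFTS**: `Q₀(toL2S λ) = 0 ⇒ Q₁(toL2S (λ∘π)) = 0`. [cite: Balaban1984PropagatorsII, (2.16)–(2.18) pp.225–226] -/
theorem topMean_cover_eq_zero (lam : Site (F.P K) 0 → Matrix (Fin 2) (Fin 2) ℂ) (h : Q₀ (toL2S F K c₀ lam) = 0) :
    Q₁ (toL2S (F.cover jc) K c₀ (fun xt => lam (proj (F.P K) jc 0 xt))) = 0 := by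
  funext yt
  rw [topMean_cover F jc hnK U₀ Q₀ hseq₀ Q₁ hseq₁, h]
  rfl

/-- ★ **THE FIBRE SUM OF THE KERNEL DESCENDS**: `Q₁(toL2S g) = 0 ⇒ Q₀(toL2S (π_* g)) = 0`. [cite: Balaban1984PropagatorsII, (2.17)–(2.19) pp.225–226] -/
theorem topMean_push_eq_zero (g : Site ((F.cover jc).P K) 0 → Matrix (Fin 2) (Fin 2) ℂ) (h : Q₁ (toL2S (F.cover jc) K c₀ g) = 0) :
    Q₀ (toL2S F K c₀ (push (F.P K) jc 0 g)) = 0 := by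
  funext y
  rw [topMean_push F jc hnK U₀ Q₀ hseq₀ Q₁ hseq₁, h, Pi.zero_apply, push_apply]
  exact Finset.sum_eq_zero fun _ _ => rfl

end Top

end Summit.QuantumFields.YangMills.Theorems.Prop7TopMeanCoverNaturality

end
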